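import Summits.NavierStokesRegularity.FluidComputer.AmplitudeLedger

/-!
# Relay budget: the two-octave budget `Q₂ = U_{n+2}/U_n = λ² · r_n · r_{n+1}` and the relay inequality

Cell `pub-fluidc` (FLUID COMPUTER; host summit `NavierStokesRegularity`, negation side, machine
paradigm), idea-1 seat gen 11 (variational / optimal-gadget lens), pre-registration
`HOME/pub-fluidc-idea-1/PREREG-R2.md` §10ae = P-G11-1, atlas `HOME/atlas/IDEA-1.md` §15.
HONEST FRAMING: low prior, high value-of-information experiment on Tao's machine paradigm;
NOT a claim that NS blows up. Nothing in this file is about the Navier–Stokes equations: these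
are elementary facts about real sequences over the dictionary of `AmplitudeLedger`
(`ampGain U n = U (n+1) / U n`, `reGain lam U n = ampGain U n / lam`).

The point (RULING R35 row (d), the "relay" objective `min(r₁, r₂)`): the level-Reynolds ratios of
two consecutive steps multiply to a quantity that does not see the intermediate level,
`r_n · r_{n+1} = U_{n+2} / (λ² U_n)` — the TWO-OCTAVE BUDGET `Q₂ := U_{n+2}/U_n` divided by `λ²`.
Hence

* `levelBudget_two_eq` — `Q₂ = λ² · r_n · r_{n+1}` (the intermediate amplitude cancels);
* `min_sq_le_mul`, `min_reGain_sq_le_budget`, `min_reGain_le_sqrt_budget` — the RELAY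
  INEQUALITY `min(r_n, r_{n+1}) ≤ √(r_n r_{n+1}) = √Q₂ / λ`: whatever smooth surrogate of the
  minimum an optimiser ascends, its value is bounded by the budget, so the maximiser of `Q₂`
  certifies an upper bound for every relay functional at once;
* `two_level_floor_budget` — two consecutive floor steps (`1 ≤ r_n`, `1 ≤ r_{n+1}`, the premise
  of the cell's K-R3-2) cost `λ² U_n ≤ U_{n+2}`, i.e. `Q₂ ≥ λ²`;
* `floor_all_budget` — `k` consecutive floor steps cost `λ^k U_n ≤ U_{n+k}`;
* `not_two_floor_of_budget_lt` — contrapositive: a control with `U_{n+2} < λ² U_n` (measured on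
  the cell's certified level-one optimum: `Q₂ = 1.25 < 4`) cannot have both steps at the floor;
* `rowA_two_octave_deficit` — the numeric anchor `λ²/Q₂ = 4/1.25 = 3.2`.

Staged by planner seat pub-fluidc-idea-1 gen 11 (`HOME/pub-fluidc-idea-1/lean/RelayBudget.lean`, sha16
18709d5652fd5c61); filed verbatim (+ one docstring; the two generic helpers `min_sq_le_mul` / `min_le_sqrt_mul` made
`private` per review of p365332, duplicates exist elsewhere in the tree) by pub-fluidc-lit gen 39 (LEAN ASK #7).
-/

namespace Summit.NavierStokesRegularity.FluidComputer.RelayBudget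

open Real Finset Filter Topology
open Summit.NavierStokesRegularity.FluidComputer.AmplitudeLedger

variable {lam : ℝ} {U : ℕ → ℝ}

/-- The `k`-level amplitude budget of the block of steps starting at level `n`:
`Q_k(n) = U_{n+k} / U_n` (for `k = 2`: the two-octave budget `Q₂` of P-G11-1). -/
noncomputable def levelBudget (U : ℕ → ℝ) (n k : ℕ) : ℝ := U (n + k) / U n

/-- One step: the budget is the amplitude gain, `Q₁(n) = g_n = λ · r_n`. -/
theorem levelBudget_one_eq (hlam : lam ≠ 0) (n : ℕ) :
    levelBudget U n 1 = lam * reGain lam U n := by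
  simp only [levelBudget, reGain, ampGain]
  field_simp

/-- The product of two consecutive level-Reynolds ratios does not see the intermediate level:
`r_n · r_{n+1} = U_{n+2} / (λ² · U_n)`. -/
theorem reGain_mul_reGain_succ (hlam : lam ≠ 0) {n : ℕ} (hU1 : U (n + 1) ≠ 0) :
    reGain lam U n * reGain lam U (n + 1) = U (n + 2) / (lam ^ 2 * U n) := by
  by_cases hU0 : U n = 0
  · simp [reGain, ampGain, hU0]
  · simp only [reGain, ampGain]
    field_simp

/-- THE BUDGET IDENTITY: `Q₂(n) = λ² · r_n · r_{n+1}`. -/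
theorem levelBudget_two_eq (hlam : lam ≠ 0) {n : ℕ} (hU1 : U (n + 1) ≠ 0) :
    levelBudget U n 2 = lam ^ 2 * (reGain lam U n * reGain lam U (n + 1)) := by
  rw [reGain_mul_reGain_succ hlam hU1, levelBudget]
  by_cases hU0 : U n = 0
  · simp [hU0]
  · field_simp

/-- `min(a, b)² ≤ a · b` for nonnegative reals. -/
private theorem min_sq_le_mul {a b : ℝ} (ha : 0 ≤ a) (hb : 0 ≤ b) : min a b ^ 2 ≤ a * b := by
  rcases le_total a b with h | h
  · rw [min_eq_left h, sq]
    exact mul_le_mul_of_nonneg_left h ha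
  · rw [min_eq_right h, sq]
    exact mul_le_mul_of_nonneg_right h hb

/-- `min(a, b) ≤ √(a · b)` for nonnegative reals (the geometric-mean bound). -/
private theorem min_le_sqrt_mul {a b : ℝ} (ha : 0 ≤ a) (hb : 0 ≤ b) : min a b ≤ Real.sqrt (a * b) := by
  have hmin : 0 ≤ min a b := le_min ha hb
  calc min a b = Real.sqrt (min a b ^ 2) := (Real.sqrt_sq hmin).symm
    _ ≤ Real.sqrt (a * b) := Real.sqrt_le_sqrt (min_sq_le_mul ha hb)

/-- Nonnegativity of a level-Reynolds ratio for nonnegative amplitudes and `λ > 0`. -/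
theorem reGain_nonneg (hlam : 0 < lam) {n : ℕ} (hU0 : 0 ≤ U n) (hU1 : 0 ≤ U (n + 1)) :
    0 ≤ reGain lam U n := by
  simp only [reGain, ampGain]
  positivity

/-- THE RELAY INEQUALITY, squared form: `min(r_n, r_{n+1})² ≤ U_{n+2} / (λ² U_n) = Q₂ / λ²`. -/
theorem min_reGain_sq_le_budget (hlam : 0 < lam) {n : ℕ} (hU0 : 0 ≤ U n) (hU1 : 0 < U (n + 1))
    (hU2 : 0 ≤ U (n + 2)) :
    min (reGain lam U n) (reGain lam U (n + 1)) ^ 2 ≤ U (n + 2) / (lam ^ 2 * U n) := by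
  rw [← reGain_mul_reGain_succ hlam.ne' hU1.ne']
  exact min_sq_le_mul (reGain_nonneg hlam hU0 hU1.le) (reGain_nonneg hlam hU1.le hU2)

/-- THE RELAY INEQUALITY: `min(r_n, r_{n+1}) ≤ √(U_{n+2} / (λ² U_n)) = √Q₂ / λ` — every relay
surrogate of the minimum is bounded by the two-octave budget. -/
theorem min_reGain_le_sqrt_budget (hlam : 0 < lam) {n : ℕ} (hU0 : 0 ≤ U n) (hU1 : 0 < U (n + 1))
    (hU2 : 0 ≤ U (n + 2)) :
    min (reGain lam U n) (reGain lam U (n + 1)) ≤ Real.sqrt (U (n + 2) / (lam ^ 2 * U n)) := by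
  rw [← reGain_mul_reGain_succ hlam.ne' hU1.ne']
  exact min_le_sqrt_mul (reGain_nonneg hlam hU0 hU1.le) (reGain_nonneg hlam hU1.le hU2)

/-- A floor step costs a factor `λ` of amplitude: `1 ≤ r_n ⟹ λ U_n ≤ U_{n+1}` (`U_n > 0`). -/
theorem lam_mul_le_of_one_le_reGain (hlam : 0 < lam) {n : ℕ} (hU0 : 0 < U n)
    (h : 1 ≤ reGain lam U n) : lam * U n ≤ U (n + 1) := by
  simp only [reGain, ampGain] at h
  rw [le_div_iff₀ hlam, one_mul, le_div_iff₀ hU0] at h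
  exact h

/-- Conversely `λ U_n ≤ U_{n+1} ⟹ 1 ≤ r_n` (`U_n > 0`, `λ > 0`). -/
theorem one_le_reGain_of_lam_mul_le (hlam : 0 < lam) {n : ℕ} (hU0 : 0 < U n)
    (h : lam * U n ≤ U (n + 1)) : 1 ≤ reGain lam U n := by
  simp only [reGain, ampGain]
  rw [le_div_iff₀ hlam, one_mul, le_div_iff₀ hU0]
  exact h

/-- TWO CONSECUTIVE FLOOR STEPS COST `Q₂ ≥ λ²`: `1 ≤ r_n → 1 ≤ r_{n+1} → λ² U_n ≤ U_{n+2}`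
(the premise of the cell's K-R3-2 reading, priced in amplitude two octaves up). -/
theorem two_level_floor_budget (hlam : 0 < lam) {n : ℕ} (hU0 : 0 < U n) (hU1 : 0 < U (n + 1))
    (h0 : 1 ≤ reGain lam U n) (h1 : 1 ≤ reGain lam U (n + 1)) :
    lam ^ 2 * U n ≤ U (n + 2) := by
  have e0 := lam_mul_le_of_one_le_reGain hlam hU0 h0
  have e1 := lam_mul_le_of_one_le_reGain hlam hU1 h1
  calc lam ^ 2 * U n = lam * (lam * U n) := by ring
    _ ≤ lam * U (n + 1) := mul_le_mul_of_nonneg_left e0 hlam.le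
    _ ≤ U (n + 2) := e1

/-- `k` CONSECUTIVE FLOOR STEPS COST `Q_k ≥ λ^k`: if `1 ≤ r_{n+i}` for all `i < k` (all
amplitudes positive), then `λ^k U_n ≤ U_{n+k}`. -/
theorem floor_all_budget (hlam : 0 < lam) {n : ℕ} (hU : ∀ i, 0 < U (n + i)) :
    ∀ k : ℕ, (∀ i < k, 1 ≤ reGain lam U (n + i)) → lam ^ k * U n ≤ U (n + k) := by
  intro k
  induction k with
  | zero => intro _; simp
  | succ k ih =>
    intro h
    have hk : lam ^ k * U n ≤ U (n + k) := ih fun i hi => h i (Nat.lt_succ_of_lt hi)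
    have hstep : lam * U (n + k) ≤ U (n + k + 1) :=
      lam_mul_le_of_one_le_reGain hlam (hU k) (h k (Nat.lt_succ_self k))
    calc lam ^ (k + 1) * U n = lam * (lam ^ k * U n) := by ring
      _ ≤ lam * U (n + k) := mul_le_mul_of_nonneg_left hk hlam.le
      _ ≤ U (n + k + 1) := hstep
      _ = U (n + (k + 1)) := by rw [Nat.add_assoc]

/-- The budget spelling of `floor_all_budget`: `k` floor steps force `λ^k ≤ Q_k(n)`. -/
theorem le_levelBudget_of_floor_all (hlam : 0 < lam) {n : ℕ} (hU : ∀ i, 0 < U (n + i)) (k : ℕ)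
    (h : ∀ i < k, 1 ≤ reGain lam U (n + i)) : lam ^ k ≤ levelBudget U n k := by
  have h0 : 0 < U n := by simpa using hU 0
  rw [levelBudget, le_div_iff₀ h0]
  exact floor_all_budget hlam hU k h

/-- CONTRAPOSITIVE (what the cell measures): a control whose two-octave budget is short,
`U_{n+2} < λ² U_n`, cannot have both steps at the floor. -/
theorem not_two_floor_of_budget_lt (hlam : 0 < lam) {n : ℕ} (hU0 : 0 < U n) (hU1 : 0 < U (n + 1))
    (hlt : U (n + 2) < lam ^ 2 * U n) :
    ¬ (1 ≤ reGain lam U n ∧ 1 ≤ reGain lam U (n + 1)) := by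
  rintro ⟨h0, h1⟩
  exact absurd (two_level_floor_budget hlam hU0 hU1 h0 h1) (not_le.mpr hlt)

/-- The same with the budget as a ratio: `Q₂(n) < λ²` excludes two consecutive floor steps. -/
theorem not_two_floor_of_levelBudget_lt (hlam : 0 < lam) {n : ℕ} (hU0 : 0 < U n)
    (hU1 : 0 < U (n + 1)) (hQ : levelBudget U n 2 < lam ^ 2) :
    ¬ (1 ≤ reGain lam U n ∧ 1 ≤ reGain lam U (n + 1)) := by
  apply not_two_floor_of_budget_lt hlam hU0 hU1
  rw [levelBudget, div_lt_iff₀ hU0] at hQ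
  exact hQ

/-- If the smaller of the two ratios is at least `m ≥ 0`, the budget is at least `λ² m²`
(how much two-octave amplitude a relay value `m` costs). -/
theorem budget_ge_of_min_ge (hlam : 0 < lam) {n : ℕ} (hU0 : 0 < U n) (hU1 : 0 < U (n + 1))
    (hU2 : 0 ≤ U (n + 2)) {m : ℝ} (hm : 0 ≤ m)
    (h : m ≤ min (reGain lam U n) (reGain lam U (n + 1))) :
    lam ^ 2 * m ^ 2 * U n ≤ U (n + 2) := by
  have hsq : m ^ 2 ≤ U (n + 2) / (lam ^ 2 * U n) :=
    le_trans (pow_le_pow_left₀ hm h 2) (min_reGain_sq_le_budget hlam hU0.le hU1 hU2)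
  have hpos : 0 < lam ^ 2 * U n := by positivity
  rw [le_div_iff₀ hpos] at hsq
  linarith [hsq]

/-! ### The budget form of the null side: a two-octave deficit at every level is regularity-side

If EVERY two-step block is short of the two-level floor by a fixed margin, `U_{n+2} ≤ (qλ)² U_n`
with `q < 1` (the cell measures `Q₂ ≈ 1.25 = (0.56·λ)²` at `λ = 2` on its best field), then the
level Reynolds numbers tend to zero — the hypothesis "`levelRe` eventually `< c`" of the
Cheskidov–Shvydkoy dyadic criterion (`AmplitudeLedger` docstring; discharged in the tree as
`Literature.Analysis.FluidPDE.cheskidov_shvydkoy_dyadic_holds`). Two-step version of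
`AmplitudeLedger.tendsto_levelRe_zero_of_eventually_gain_le`. -/

/-- A short two-step block lowers the level Reynolds number two levels up by `q²`:
`U_{n+2} ≤ (qλ)² U_n ⟹ Re_{n+2} ≤ q² Re_n`. -/
theorem levelRe_add_two_le_of_budget_le {ν k0 : ℝ} (hν : 0 < ν) (hk0 : 0 < k0) (hlam : 0 < lam)
    {q : ℝ} {n : ℕ} (h : U (n + 2) ≤ (q * lam) ^ 2 * U n) :
    levelRe ν k0 lam U (n + 2) ≤ q ^ 2 * levelRe ν k0 lam U n := by
  have hD : 0 < ν * levelK k0 lam (n + 2) := mul_pos hν (levelK_pos hk0 hlam _)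
  have step : U (n + 2) / (ν * levelK k0 lam (n + 2))
      ≤ (q * lam) ^ 2 * U n / (ν * levelK k0 lam (n + 2)) := by
    gcongr
  calc levelRe ν k0 lam U (n + 2) = U (n + 2) / (ν * levelK k0 lam (n + 2)) := rfl
    _ ≤ (q * lam) ^ 2 * U n / (ν * levelK k0 lam (n + 2)) := step
    _ = q ^ 2 * levelRe ν k0 lam U n := by
      simp only [levelRe, levelK]
      field_simp
      ring

/-- THE BUDGET FORM OF THE NULL SIDE: if every two-step block satisfies `U_{n+2} ≤ (qλ)² U_n` with
`0 < q < 1` and all amplitudes are nonnegative, then `Re_n → 0` (geometric bound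
`Re_n ≤ max(Re_0, Re_1/q) · qⁿ`). -/
theorem tendsto_levelRe_zero_of_budget_two_le {ν k0 : ℝ} (hν : 0 < ν) (hk0 : 0 < k0)
    (hlam : 0 < lam) {q : ℝ} (hq0 : 0 < q) (hq1 : q < 1) (hU : ∀ n, 0 ≤ U n)
    (h : ∀ n, U (n + 2) ≤ (q * lam) ^ 2 * U n) :
    Tendsto (fun n => levelRe ν k0 lam U n) atTop (𝓝 0) := by
  set K : ℝ := max (levelRe ν k0 lam U 0) (levelRe ν k0 lam U 1 / q) with hK
  have two : ∀ n, levelRe ν k0 lam U n ≤ K * q ^ n ∧ levelRe ν k0 lam U (n + 1) ≤ K * q ^ (n + 1) := by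
    intro n
    induction n with
    | zero =>
      refine ⟨by simp [hK], ?_⟩
      have : levelRe ν k0 lam U 1 = levelRe ν k0 lam U 1 / q * q := by field_simp
      rw [this, zero_add, pow_one]
      exact mul_le_mul_of_nonneg_right (le_max_right _ _) hq0.le
    | succ n ih =>
      refine ⟨ih.2, ?_⟩
      calc levelRe ν k0 lam U (n + 1 + 1) = levelRe ν k0 lam U (n + 2) := rfl
        _ ≤ q ^ 2 * levelRe ν k0 lam U n := levelRe_add_two_le_of_budget_le hν hk0 hlam (h n)
        _ ≤ q ^ 2 * (K * q ^ n) := mul_le_mul_of_nonneg_left ih.1 (sq_nonneg q)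
        _ = K * q ^ (n + 1 + 1) := by ring
  have h0 : ∀ n, 0 ≤ levelRe ν k0 lam U n := fun n => levelRe_nonneg hν hk0 hlam (hU n)
  have hlim : Tendsto (fun n => K * q ^ n) atTop (𝓝 0) := by
    simpa using (tendsto_pow_atTop_nhds_zero_of_lt_one hq0.le hq1).const_mul K
  exact squeeze_zero h0 (fun n => (two n).1) hlim

/-- Numeric anchor of record (row (a) of the cell's R3 pass 0, three engines): the certified
level-one optimum carries `Q₂ = 1.25`, so the two-octave deficit to the two-level floor `λ² = 4`
is `4 / 1.25 = 3.2`, and the equal-sharing relay value is `√1.25 / 2 < 0.56 < 1`. -/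
theorem rowA_two_octave_deficit : (4 : ℝ) / 1.25 = 3.2 ∧ (1.25 : ℝ) < (2 : ℝ) ^ 2 := by
  constructor <;> norm_num

/-- The equal-sharing relay value of the same anchor: `√Q₂ / λ = √1.25 / 2 < 0.56` (`< 1`). -/
theorem rowA_equal_share_lt : Real.sqrt 1.25 / 2 < 0.56 := by
  have h : Real.sqrt 1.25 < 1.12 := by
    rw [show (1.25 : ℝ) = 1.25 from rfl, Real.sqrt_lt' (by norm_num)]
    norm_num
  linarith

end Summit.NavierStokesRegularity.FluidComputer.RelayBudget
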